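import Summits.Langlands.Statement
import Summits.Langlands.Langlands.Theorems.BaseFieldAscentAscentConjugationSolvableStubPrimeTowerInduction

/-!
# Conjugation-solvable induction (crux stmt-Langlands-1094 `BaseFieldAscent.AscentConjugationSolvable`,
line `registered`; `--supports` file, closes nothing)

The CURRENCY-FREE form of the line's composition.  A number field `F` is *conjugation-solvable* when
`F₀ ⊆ F ⊆ E` with `F₀` totally real and `E/F₀` finite Galois with solvable group (the inline typing of
the crux).  For an ARBITRARY property `P` of number fields:

  if `P` climbs every Galois layer of prime degree (`P K → P L`), descends every Galois layer of prime
  degree (`P L → P K`), and holds for every totally real field, then `P` holds for every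
  conjugation-solvable field                                   (`conjugationSolvable_induction`).

With `P X := ∃ R : ReciprocityData X, ∀ n > 0, ∀ hcpt, GlobalLanglandsCorrespondenceGLn n X R hcpt` this is
the landed composition `ascentConjugationSolvable_of_primeLayers` (Theorems/…OfPrimeLayers.lean); the point
of the present statement is that it is insensitive to the CURRENCY in which reciprocity is written — the
summit was re-typed (p141787, 2026-08-17) to `∀ F, Nonempty (ReciprocityData F) ∧ ∀ 𝓡 …`, and whichever
re-typing of the crux and of its two prime-layer pieces (stmt-Langlands-18649 / 18645) the planners adopt
(`∃ R`, `∀ 𝓡`, `Nonempty ∧ ∀ 𝓡`, datum-wise transfer), the glue is this theorem instantiated at the new `P`.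

Proof: the landed prime-step tower principle `stub_primeTowerInduction` (p150349), used UP with `P` and
DOWN with the ascending predicate `X ↦ (P X → P F)`; the degenerate layers `[E:F] = 1`, `[F:F₀] = 1` are
settled by transporting only `IsGalois` / `IsSolvable` / `IsTotallyReal` along `F ≃ₐ[F₀] E`, resp.
`F₀ ≃+* F` — never `P`.

References: folklore (solvable Galois theory); the mechanism is that of J. Arthur, L. Clozel, Ann. of
Math. Stud. 120 (1989), Ch. 3 [ArthurClozelAMS120] (reciprocity moved along cyclic layers of prime degree).
-/

set_option linter.dupNamespace false -- mandated Summit.Langlands.Langlands namespace (D-0017)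

noncomputable section

namespace Summit.Langlands.Langlands.Theorems.BaseFieldAscentAscentConjugationSolvable

/-- **Conjugation-solvable induction.** Let `P` be any property of number fields which (i) climbs every
Galois layer `L/K` of prime degree, (ii) descends every Galois layer `L/K` of prime degree, and (iii) holds
for every totally real field. Then `P F` holds for every number field `F` admitting a totally real subfield
`F₀` and a finite Galois extension `E ⊇ F` of `F₀` with solvable Galois group (`F` conjugation-solvable,
typed inline exactly as in the crux `AscentConjugationSolvable`). UP from `F₀` to `E` (or to `F` when
`[E:F] = 1`) by the prime-step tower principle, DOWN from `E` to `F` by the same principle applied to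
`X ↦ (P X → P F)`; `[F:F₀] = [E:F] = 1` makes `F` itself totally real. [folklore] -/
theorem conjugationSolvable_induction : ∀ (P : (K : Type) → [Field K] → [NumberField K] → Prop), (∀ (K L : Type) [Field K] [NumberField K] [Field L] [NumberField L] [Algebra K L] [IsGalois K L], (Module.finrank K L).Prime → P K → P L) → (∀ (K L : Type) [Field K] [NumberField K] [Field L] [NumberField L] [Algebra K L] [IsGalois K L], (Module.finrank K L).Prime → P L → P K) → (∀ (F : Type) [Field F] [NumberField F], NumberField.IsTotallyReal F → P F) → ∀ (F : Type) [Field F] [NumberField F], (∃ (F₀ E : Type) (_ : Field F₀) (_ : NumberField F₀) (_ : Field E) (_ : NumberField E) (_ : Algebra F₀ F) (_ : Algebra F E) (_ : Algebra F₀ E) (_ : IsScalarTower F₀ F E) (_ : IsGalois F₀ E), NumberField.IsTotallyReal F₀ ∧ IsSolvable (E ≃ₐ[F₀] E)) → P F := by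
  intro P hUp hDown hTR F _ _ hF
  obtain ⟨F₀, E, iF₀, iNF₀, iE, iNE, iA₀, iA, iA₀E, iST, iGal, hTR₀, hsolv⟩ := hF
  letI := iF₀; letI := iNF₀; letI := iE; letI := iNE; letI := iA₀; letI := iA; letI := iA₀E
  haveI := iST; haveI := iGal
  -- (1) `P` over the totally real floor `F₀`
  have hPF₀ : P F₀ := hTR F₀ hTR₀
  haveI : FiniteDimensional F₀ E := Module.Finite.of_restrictScalars_finite ℚ F₀ E
  haveI : FiniteDimensional F₀ F := Module.Finite.of_restrictScalars_finite ℚ F₀ F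
  haveI : FiniteDimensional F E := Module.Finite.of_restrictScalars_finite ℚ F E
  -- (2) `E/F` is Galois, and `Gal(E/F)` embeds in the solvable `Gal(E/F₀)`
  haveI : IsGalois F E := IsGalois.tower_top_of_isGalois F₀ F E
  have hsolvF : IsSolvable (E ≃ₐ[F] E) := by
    let φ : (E ≃ₐ[F] E) →* (E ≃ₐ[F₀] E) :=
      { toFun := fun σ => σ.restrictScalars F₀
        map_one' := AlgEquiv.ext fun _ => rfl
        map_mul' := fun _ _ => AlgEquiv.ext fun _ => rfl }
    haveI : IsSolvable (E ≃ₐ[F₀] E) := hsolv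
    exact solvable_of_solvable_injective (f := φ) (AlgEquiv.restrictScalars_injective F₀)
  by_cases hFE : Module.finrank F E = 1
  · -- (3a) degenerate top layer: `F ≃ E` over `F₀`, so `F/F₀` is itself Galois with solvable group
    have hbij : Function.Bijective (algebraMap F E) :=
      (Algebra.finrank_eq_one_iff_bijective_algebraMap).mp hFE
    let e : F ≃ₐ[F₀] E := AlgEquiv.ofBijective (IsScalarTower.toAlgHom F₀ F E) hbij
    haveI : IsGalois F₀ F := IsGalois.of_algEquiv e.symm
    have hsolvF₀F : IsSolvable (F ≃ₐ[F₀] F) := by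
      haveI : IsSolvable (E ≃ₐ[F₀] E) := hsolv
      exact solvable_of_surjective (f := e.symm.autCongr.toMonoidHom) e.symm.autCongr.surjective
    by_cases hF₀F : Module.finrank F₀ F = 1
    · -- doubly degenerate: `F ≃ F₀` is totally real, hypothesis (iii) applies to `F` itself
      have hbij₀ : Function.Bijective (algebraMap F₀ F) :=
        (Algebra.finrank_eq_one_iff_bijective_algebraMap).mp hF₀F
      haveI : NumberField.IsTotallyReal F₀ := hTR₀
      exact hTR F (NumberField.IsTotallyReal.ofRingEquiv (RingEquiv.ofBijective (algebraMap F₀ F) hbij₀))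
    · -- UP from `F₀` to `F` along the solvable Galois extension `F/F₀` of degree `> 1`
      exact stub_primeTowerInduction P hUp F₀ F hsolvF₀F
        (lt_of_le_of_ne (Nat.succ_le_of_lt Module.finrank_pos) (Ne.symm hF₀F)) hPF₀
  · -- (3b) generic case: `1 < [E:F] ≤ [E:F₀]`
    have hltFE : 1 < Module.finrank F E :=
      lt_of_le_of_ne (Nat.succ_le_of_lt Module.finrank_pos) (Ne.symm hFE)
    have hltE : 1 < Module.finrank F₀ E :=
      calc 1 < Module.finrank F E := hltFE
        _ ≤ Module.finrank F₀ F * Module.finrank F E := Nat.le_mul_of_pos_left _ Module.finrank_pos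
        _ = Module.finrank F₀ E := Module.finrank_mul_finrank F₀ F E
    -- UP: climb the solvable Galois extension `E/F₀` prime layer by prime layer
    have hPE : P E := stub_primeTowerInduction P hUp F₀ E hsolv hltE hPF₀
    -- DOWN: the ascending predicate `X ↦ (P X → P F)` holds at `F` trivially and climbs each prime layer by
    -- prime descent composed on the left; evaluate it at `E`.
    have hDesc : P E → P F :=
      stub_primeTowerInduction (fun (K : Type) [Field K] [NumberField K] => P K → P F)
        (fun K L _ _ _ _ _ _ hp hK hL => hK (hDown K L hp hL)) F E hsolvF hltFE id
    exact hDesc hPE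

/-- **The crux in the RE-TYPED currency, as an instance.** Write
`Recip′ X := Nonempty (ReciprocityData X) ∧ ∀ 𝓡 : ReciprocityData X, ∀ n > 0, ∀ hcpt, GlobalLanglandsCorrespondenceGLn n X 𝓡 hcpt`
(the body of the re-typed summit `Langlands`, p141787, at one field). If `Recip′` climbs and descends Galois layers
of prime degree, then `Recip′` over every totally real or CM field gives `Recip′` over every conjugation-solvable
field — i.e. the crux `AscentConjugationSolvable` re-typed in the summit's new currency follows from the
correspondingly re-typed prime-layer pieces by `conjugationSolvable_induction`, with no new mathematics. (Not a
route decl: recorded for the planners' re-typing of routes BaseFieldAscent / CMFern / SmithKummerSeed.) [folklore] -/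
theorem ascentConjugationSolvable_forallDatum_of_primeLayers
    (hUp : ∀ (K L : Type) [Field K] [NumberField K] [Field L] [NumberField L] [Algebra K L] [IsGalois K L],
      (Module.finrank K L).Prime →
      (Nonempty (Summit.Langlands.ReciprocityData K) ∧ ∀ (𝓡 : Summit.Langlands.ReciprocityData K) (n : ℕ),
        0 < n → ∀ hcpt : Literature.NumberTheory.Automorphic.isCompact_glFiniteIntegralLevel n K,
          Summit.Langlands.GlobalLanglandsCorrespondenceGLn n K 𝓡 hcpt) →
      Nonempty (Summit.Langlands.ReciprocityData L) ∧ ∀ (𝓡 : Summit.Langlands.ReciprocityData L) (n : ℕ),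
        0 < n → ∀ hcpt : Literature.NumberTheory.Automorphic.isCompact_glFiniteIntegralLevel n L,
          Summit.Langlands.GlobalLanglandsCorrespondenceGLn n L 𝓡 hcpt)
    (hDown : ∀ (K L : Type) [Field K] [NumberField K] [Field L] [NumberField L] [Algebra K L] [IsGalois K L],
      (Module.finrank K L).Prime →
      (Nonempty (Summit.Langlands.ReciprocityData L) ∧ ∀ (𝓡 : Summit.Langlands.ReciprocityData L) (n : ℕ),
        0 < n → ∀ hcpt : Literature.NumberTheory.Automorphic.isCompact_glFiniteIntegralLevel n L,
          Summit.Langlands.GlobalLanglandsCorrespondenceGLn n L 𝓡 hcpt) →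
      Nonempty (Summit.Langlands.ReciprocityData K) ∧ ∀ (𝓡 : Summit.Langlands.ReciprocityData K) (n : ℕ),
        0 < n → ∀ hcpt : Literature.NumberTheory.Automorphic.isCompact_glFiniteIntegralLevel n K,
          Summit.Langlands.GlobalLanglandsCorrespondenceGLn n K 𝓡 hcpt)
    (hTRCM : ∀ (F : Type) [Field F] [NumberField F],
      (NumberField.IsTotallyReal F ∨ NumberField.IsCMField F) →
      Nonempty (Summit.Langlands.ReciprocityData F) ∧ ∀ (𝓡 : Summit.Langlands.ReciprocityData F) (n : ℕ),
        0 < n → ∀ hcpt : Literature.NumberTheory.Automorphic.isCompact_glFiniteIntegralLevel n F,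
          Summit.Langlands.GlobalLanglandsCorrespondenceGLn n F 𝓡 hcpt) :
    ∀ (F : Type) [Field F] [NumberField F],
      (∃ (F₀ E : Type) (_ : Field F₀) (_ : NumberField F₀) (_ : Field E) (_ : NumberField E)
        (_ : Algebra F₀ F) (_ : Algebra F E) (_ : Algebra F₀ E) (_ : IsScalarTower F₀ F E) (_ : IsGalois F₀ E),
        NumberField.IsTotallyReal F₀ ∧ IsSolvable (E ≃ₐ[F₀] E)) →
      Nonempty (Summit.Langlands.ReciprocityData F) ∧ ∀ (𝓡 : Summit.Langlands.ReciprocityData F) (n : ℕ),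
        0 < n → ∀ hcpt : Literature.NumberTheory.Automorphic.isCompact_glFiniteIntegralLevel n F,
          Summit.Langlands.GlobalLanglandsCorrespondenceGLn n F 𝓡 hcpt :=
  fun F _ _ hF =>
    conjugationSolvable_induction
      (fun (K : Type) [Field K] [NumberField K] =>
        Nonempty (Summit.Langlands.ReciprocityData K) ∧ ∀ (𝓡 : Summit.Langlands.ReciprocityData K) (n : ℕ),
          0 < n → ∀ hcpt : Literature.NumberTheory.Automorphic.isCompact_glFiniteIntegralLevel n K,
            Summit.Langlands.GlobalLanglandsCorrespondenceGLn n K 𝓡 hcpt)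
      hUp hDown (fun F₁ _ _ h => hTRCM F₁ (Or.inl h)) F hF

end Summit.Langlands.Langlands.Theorems.BaseFieldAscentAscentConjugationSolvable

end
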